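import Literature.MathematicalPhysics.QuantumLattice.FermionDeterminantBound
import Literature.MathematicalPhysics.QuantumLattice.HubbardLinkedCluster
import Literature.Analysis.Matrix.DetAddDiagonalMinors

/-!
# The `n!`-free bound for SHIFTED time-ordered propagator determinants `det (G − diagonal d)`

The coefficients of a tadpole-subtracted (Hartree-renormalised) fermionic expansion are determinants
`det (G − diagonal d)` of the pair-indexed time-ordered free propagator matrix `G = propMatrix β h o o' τ`
(`HubbardLinkedCluster.propMatrix`) with the shifts `d` subtracted on the diagonal (the shifted Wick
theorem, `ShiftedWickDeterminant`). Their `n!`-free bound follows from the tree's operator-side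
determinant bound for time-ordered propagator matrices
(`FermionDeterminantBound.norm_det_timeOrderedPropagator_le`: `|det G| ≤ ∏ₐ Fₐ ∏_b G_b` with the
`ℓ²` norms `Fₐ`, `G_b` of the columns / rows of the one-body evolutions) and the principal-minor
expansion of a diagonal shift (`Literature.Analysis.Matrix.det_add_diagonal_eq_sum_minors`): every
principal minor of `G` is again a time-ordered propagator matrix (`propMatrix_submatrix`), so

* `norm_det_propMatrix_le` — `‖det (propMatrix β h o o' τ)‖ ≤ ∏ₐ (‖(e^{τₐh})_{·,oₐ}‖₂ · ‖(e^{−τₐh})_{o'ₐ,·}‖₂)`;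
* `norm_det_propMatrix_sub_diagonal_le` —
  **`‖det (propMatrix β h o o' τ − diagonal d)‖ ≤ ∏ₐ (‖(e^{τₐh})_{·,oₐ}‖₂ · ‖(e^{−τₐh})_{o'ₐ,·}‖₂ + ‖dₐ‖)`**
  (`Σ_S ∏_{a∉S}|dₐ| ∏_{a∈S} FₐGₐ = ∏ₐ (FₐGₐ + |dₐ|)`): the shifts enter ADDITIVELY in each factor, so
  Hartree counterterms `|ν| ≤ 1` cost at most a factor `(e^{2|τ|‖h‖} + 1)ⁿ` — still no `n!`.

Benfatto–Giuliani–Mastropietro 2006 §2.8 (2.80) (determinant bounds with the counterterm `ν` inside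
the propagator matrix); Feldman–Knörrer–Trubowitz 2002 §1.5. Everything proved, no definitions.
[cite: BenfattoGiulianiMastropietro2006, §2.8 (2.80)]
-/

noncomputable section

open scoped Matrix ComplexOrder
open Finset NormedSpace

namespace Literature.MathematicalPhysics.QuantumLattice

variable {ι : Type*} [LinearOrder ι] [Fintype ι]

/-- **The `n!`-free bound for the pair-indexed time-ordered propagator matrix**: for Hermitian `h`,
real `β`, orbitals `o, o'` and complex pair times `τ`,
`‖det (propMatrix β h o o' τ)‖ ≤ ∏ₐ √(Σₘ |(e^{τₐh})_{m,oₐ}|²) · √(Σₘ |(e^{−τₐh})_{o'ₐ,m}|²)`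
(`norm_det_timeOrderedPropagator_le` with the interleaving pattern `k_b = b + 1`, i.e. creation of
pair `a` to the left of the annihilation of pair `b` iff `a ≤ b`). [cite: BenfattoGiulianiMastropietro2006, §2.8 (2.80)] -/
theorem norm_det_propMatrix_le {h : Matrix ι ι ℂ} (hh : h.IsHermitian) (β : ℝ) {n : ℕ}
    (o o' : Fin n → ι) (τ : Fin n → ℂ) :
    ‖(propMatrix β h o o' τ).det‖ ≤
      ∏ a, (Real.sqrt (∑ m, ‖exp (τ a • h) m (o a)‖ ^ 2) *
        Real.sqrt (∑ m, ‖exp (-(τ a • h)) (o' a) m‖ ^ 2)) := by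
  have hM : propMatrix β h o o' τ = Matrix.of fun a b : Fin n =>
      if (a : ℕ) < (b : ℕ) + 1 then
        (exp (-(τ b • h)) * (1 + exp ((β : ℂ) • h))⁻¹ * exp (τ a • h)) (o' b) (o a)
      else -(exp (-(τ b • h)) * (1 + exp (-((β : ℂ) • h)))⁻¹ * exp (τ a • h)) (o' b) (o a) := by
    ext a b
    simp only [propMatrix, Matrix.of_apply, Nat.lt_succ_iff, Fin.le_iff_val_le_val]
  rw [hM, Finset.prod_mul_distrib]
  exact norm_det_timeOrderedPropagator_le hh β o o' τ τ (fun b => (b : ℕ) + 1)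
    (fun a b hab => Nat.succ_le_succ (Fin.le_def.mp hab)) (fun b => b.isLt)

/-- **The `n!`-free bound for SHIFTED time-ordered propagator determinants**: for Hermitian `h`,
real `β`, orbitals `o, o'`, complex pair times `τ` and complex shifts `d`,
`‖det (propMatrix β h o o' τ − diagonal d)‖ ≤ ∏ₐ (√(Σₘ |(e^{τₐh})_{m,oₐ}|²) · √(Σₘ |(e^{−τₐh})_{o'ₐ,m}|²) + ‖dₐ‖)`
— the principal-minor expansion of the diagonal shift, the bound `norm_det_propMatrix_le` for every
principal minor (again a `propMatrix`, `propMatrix_submatrix`), and `Σ_S ∏_{a∉S}|dₐ| ∏_{a∈S} xₐ = ∏ₐ (xₐ + |dₐ|)`.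
The tadpole / Hartree counterterms of a renormalised expansion therefore do not spoil the
determinant bound. [cite: BenfattoGiulianiMastropietro2006, §2.8 (2.80)] -/
theorem norm_det_propMatrix_sub_diagonal_le {h : Matrix ι ι ℂ} (hh : h.IsHermitian) (β : ℝ) {n : ℕ}
    (o o' : Fin n → ι) (τ : Fin n → ℂ) (d : Fin n → ℂ) :
    ‖(propMatrix β h o o' τ - Matrix.diagonal d).det‖ ≤
      ∏ a, (Real.sqrt (∑ m, ‖exp (τ a • h) m (o a)‖ ^ 2) *
        Real.sqrt (∑ m, ‖exp (-(τ a • h)) (o' a) m‖ ^ 2) + ‖d a‖) := by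
  -- the column/row weights
  set w : Fin n → ℝ := fun a => Real.sqrt (∑ m, ‖exp (τ a • h) m (o a)‖ ^ 2) *
    Real.sqrt (∑ m, ‖exp (-(τ a • h)) (o' a) m‖ ^ 2) with hw
  -- principal-minor expansion of the diagonal shift
  have hdiag : propMatrix β h o o' τ - Matrix.diagonal d =
      propMatrix β h o o' τ + Matrix.diagonal (fun a => -d a) := by
    ext a b
    simp only [Matrix.sub_apply, Matrix.add_apply, Matrix.diagonal_apply]
    split_ifs <;> ring
  rw [hdiag, Literature.Analysis.Matrix.det_add_diagonal_eq_sum_minors]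
  -- every principal minor is a time-ordered propagator matrix, bounded by the product of its weights
  have hminor : ∀ S : Finset (Fin n),
      ‖((propMatrix β h o o' τ).submatrix ((↑) : S → Fin n) ((↑) : S → Fin n)).det‖ ≤ ∏ a ∈ S, w a := by
    intro S
    have hre : ((propMatrix β h o o' τ).submatrix ((↑) : S → Fin n) ((↑) : S → Fin n)).det =
        ((propMatrix β h o o' τ).submatrix (S.orderEmbOfFin rfl) (S.orderEmbOfFin rfl)).det := by
      have : (propMatrix β h o o' τ).submatrix (S.orderEmbOfFin rfl) (S.orderEmbOfFin rfl) =
          ((propMatrix β h o o' τ).submatrix ((↑) : S → Fin n) ((↑) : S → Fin n)).submatrix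
            (S.orderIsoOfFin rfl).toEquiv (S.orderIsoOfFin rfl).toEquiv := by
        ext a b
        rfl
      rw [this, Matrix.det_submatrix_equiv_self]
    rw [hre, propMatrix_submatrix]
    calc ‖(propMatrix β h (o ∘ S.orderEmbOfFin rfl) (o' ∘ S.orderEmbOfFin rfl) (τ ∘ S.orderEmbOfFin rfl)).det‖
        ≤ ∏ k, w (S.orderEmbOfFin rfl k) :=
          norm_det_propMatrix_le hh β (o ∘ S.orderEmbOfFin rfl) (o' ∘ S.orderEmbOfFin rfl)
            (τ ∘ S.orderEmbOfFin rfl)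
      _ = ∏ a ∈ S, w a := by
          rw [← Finset.prod_coe_sort S, ← (S.orderIsoOfFin rfl).toEquiv.prod_comp]
          rfl
  -- sum up
  calc ‖∑ S : Finset (Fin n), (∏ i ∈ Sᶜ, -d i) *
        ((propMatrix β h o o' τ).submatrix ((↑) : S → Fin n) ((↑) : S → Fin n)).det‖
      ≤ ∑ S : Finset (Fin n), ‖(∏ i ∈ Sᶜ, -d i) *
          ((propMatrix β h o o' τ).submatrix ((↑) : S → Fin n) ((↑) : S → Fin n)).det‖ :=
        norm_sum_le _ _
    _ ≤ ∑ S : Finset (Fin n), (∏ i ∈ Sᶜ, ‖d i‖) * ∏ a ∈ S, w a := by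
        refine Finset.sum_le_sum fun S _ => ?_
        rw [norm_mul, norm_prod]
        simp only [norm_neg]
        exact mul_le_mul_of_nonneg_left (hminor S) (Finset.prod_nonneg fun i _ => norm_nonneg _)
    _ = ∏ a, (w a + ‖d a‖) := by
        rw [Finset.prod_add, Finset.powerset_univ]
        refine Finset.sum_congr rfl fun S _ => ?_
        rw [mul_comm, Finset.compl_eq_univ_sdiff]

end Literature.MathematicalPhysics.QuantumLattice
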